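import Literature.MathematicalPhysics.QuantumManyBody.TorusFockSectorInteraction
import HarnessLib

/-!
# Route `BECConjugateDomination`, glue `IMUChainGlue` (stmt-AtomisticToContinuum-11790) —
# helper: the constant trial state and the energy input of step (iv)

On the torus of side `L` the constant `N`-particle state `Ψ ≡ L^{-3N/2}` is an admissible periodic
trial state with energy `C(N,2) · L⁻³ ∫_{ℝ³} v(|x|) dx` (no kinetic energy; the pair interaction of
a symmetric density is `C(N,2)` times one pair, and the periodisation unfolds to `ℝ³`), whence
`E₀^per(N,L) ≤ C(N,2) L⁻³ ‖ṽ‖₁`; for a minimiser this bounds the kinetic energy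
`T ≤ periodicEnergy = E₀^per`, the input `T/N ≤ ρ‖ṽ‖₁/2` of step (iv) of the glue.  Also: a
potential of the route's smooth class (finite, continuous as `x ↦ v(|x|)`, finite range) has
`‖ṽ‖₁ = ∫ v(|x|) dx < ∞`.
-/

noncomputable section

open MeasureTheory Set Filter
open scoped ENNReal NNReal Topology

namespace Summit.AtomisticToContinuum.BoseEinsteinCondensation.Theorems.IMUChainGlue

open Literature.MathematicalPhysics.QuantumManyBody.BoseGas

variable {L : ℝ}

/-! ### The constant trial state -/

/-- `‖L^{-3N/2}‖₊² = (L^{3N})⁻¹` in `ℝ≥0∞`. -/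
theorem nnnorm_constN_sq (hL : 0 < L) (N : ℕ) :
    ((‖((Real.sqrt ((L ^ 3) ^ N))⁻¹ : ℂ)‖₊ : ℝ≥0∞) ^ 2) = ((ENNReal.ofReal L ^ 3) ^ N)⁻¹ := by
  have hLN : 0 < (L ^ 3) ^ N := by positivity
  have hc : ((‖((Real.sqrt ((L ^ 3) ^ N))⁻¹ : ℂ)‖₊ : ℝ≥0∞) ^ 2) = ENNReal.ofReal (((L ^ 3) ^ N)⁻¹) := by
    rw [← ENNReal.coe_pow, ENNReal.ofReal, ENNReal.coe_inj]
    ext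
    rw [NNReal.coe_pow, coe_nnnorm, norm_inv, Complex.norm_real,
      Real.norm_of_nonneg (Real.sqrt_nonneg _), inv_pow, Real.sq_sqrt hLN.le,
      Real.coe_toNNReal _ (by positivity)]
  rw [hc, ENNReal.ofReal_inv_of_pos hLN, ENNReal.ofReal_pow (by positivity), ENNReal.ofReal_pow hL.le]

/-- The normalisation of the constant state: `∫_{cell^N} L^{-3N} = 1`. -/
theorem setLIntegral_nnnorm_constN_sq (hL : 0 < L) (N : ℕ) :
    ∫⁻ _ in cellN N L, ((‖((Real.sqrt ((L ^ 3) ^ N))⁻¹ : ℂ)‖₊ : ℝ≥0∞) ^ 2) = 1 := by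
  have h0 : (ENNReal.ofReal L ^ 3) ^ N ≠ 0 := pow_ne_zero _ (pow_ne_zero _ (by simpa using hL))
  have htop : (ENNReal.ofReal L ^ 3) ^ N ≠ ⊤ := ENNReal.pow_ne_top (ENNReal.pow_ne_top ENNReal.ofReal_ne_top)
  rw [setLIntegral_const, volume_cellN, nnnorm_constN_sq hL N, ENNReal.inv_mul_cancel h0 htop]

/-- **The pair integral against the hybrid measure**:
`∫ v(|x₀ - x₁|) dx₀ dX'|_{cell^{m+1}} = ‖ṽ‖₁ · L^{3(m+1)}` (shear `x₀ ↦ x₀ + x₁`). -/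
theorem lintegral_hybrid_pot (L : ℝ) {v : ℝ → ℝ≥0∞} (hv : Measurable v) (m : ℕ) :
    ∫⁻ X, v ‖X 0 - X 1‖ ∂(hybridMeasure L m) = (∫⁻ x : Space, v ‖x‖) * (ENNReal.ofReal L ^ 3) ^ (m + 1) := by
  have hsplit := measurePreserving_hybrid_split L m
  have hsub : Measurable fun z : Space × Config (m + 1) => z.1 - z.2 0 :=
    measurable_fst.sub ((measurable_pi_apply 0).comp measurable_snd)
  have hg : Measurable fun z : Space × Config (m + 1) => v ‖z.1 - z.2 0‖ :=
    hv.comp (measurable_norm.comp hsub)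
  have h1 : ∫⁻ X, v ‖X 0 - X 1‖ ∂(hybridMeasure L m) =
      ∫⁻ z, v ‖z.1 - z.2 0‖ ∂((volume : Measure Space).prod (volume.restrict (cellN (m + 1) L))) := by
    rw [← hsplit.lintegral_comp hg]
    rfl
  have h2 := (measurePreserving_shear L m).lintegral_comp hg
  simp only [add_sub_cancel_right] at h2
  rw [h1, ← h2, lintegral_prod (fun z : Space × Config (m + 1) => v ‖z.1‖)
    (hv.comp (measurable_norm.comp measurable_fst)).aemeasurable]
  simp only [lintegral_const, Measure.restrict_apply_univ, volume_cellN]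
  exact lintegral_mul_const _ (hv.comp measurable_norm)

/-- **The energy of the constant state bounds the ground-state energy**:
`E₀^per(N, L) ≤ C(N,2) · L⁻³ ∫_{ℝ³} v(|x|) dx` for `N = m + 2`. -/
theorem periodicGroundStateEnergy_le_pairs (hL : 0 < L) {v : ℝ → ℝ≥0∞} (hv : Measurable v) (m : ℕ) :
    periodicGroundStateEnergy v (m + 2) L ≤
      (((m + 2).choose 2 : ℕ) : ℝ≥0∞) * ((ENNReal.ofReal L ^ 3)⁻¹ * ∫⁻ x : Space, v ‖x‖) := by
  set c : ℂ := ((Real.sqrt ((L ^ 3) ^ (m + 2)))⁻¹ : ℂ) with hc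
  let Ψ : PeriodicTrialState (m + 2) L :=
    ⟨fun _ => c, contDiff_const, fun _ _ _ => rfl, fun _ _ => rfl, setLIntegral_nnnorm_constN_sq hL _⟩
  refine (periodicGroundStateEnergy_le v Ψ).trans (le_of_eq ?_)
  have hK : ((‖c‖₊ : ℝ≥0∞) ^ 2) = ((ENNReal.ofReal L ^ 3) ^ (m + 2))⁻¹ := nnnorm_constN_sq hL _
  have hKtop : ((‖c‖₊ : ℝ≥0∞) ^ 2) ≠ ⊤ := ENNReal.pow_ne_top ENNReal.coe_ne_top
  -- no kinetic energy
  have hkin : ∀ X : Config (m + 2), kineticDensity (fun _ : Config (m + 2) => c) X = 0 := fun X => by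
    simp [kineticDensity]
  have hE : periodicEnergy v Ψ = (∫⁻ X in cellN (m + 2) L, periodicInteraction v L X * 1) * (‖c‖₊ : ℝ≥0∞) ^ 2 := by
    rw [periodicEnergy, ← lintegral_mul_const' _ _ hKtop]
    refine lintegral_congr fun X => ?_
    show kineticDensity (fun _ : Config (m + 2) => c) X + periodicInteraction v L X * (‖c‖₊ : ℝ≥0∞) ^ 2 = _
    rw [hkin, zero_add, mul_one]
  rw [hE, lintegral_cellN_periodicInteraction_mul_symm hv L measurable_const (fun _ _ => rfl),
    lintegral_cellN_periodizedPotential_mul hL hv measurable_const (fun _ _ _ => rfl)]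
  simp only [mul_one]
  rw [lintegral_hybrid_pot L hv m, hK]
  -- `L^{3(m+1)} · (L^{3(m+2)})⁻¹ = L⁻³`
  have h0 : ENNReal.ofReal L ^ 3 ≠ 0 := pow_ne_zero _ (by simpa using hL)
  have htop : ENNReal.ofReal L ^ 3 ≠ ⊤ := ENNReal.pow_ne_top ENNReal.ofReal_ne_top
  rw [ENNReal.inv_pow, pow_succ _ (m + 1), mul_assoc, mul_assoc, ← mul_assoc ((ENNReal.ofReal L ^ 3) ^ (m + 1)),
    ← mul_pow, ENNReal.mul_inv_cancel h0 htop, one_pow, one_mul, mul_comm (∫⁻ x : Space, v ‖x‖)]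

/-- **The kinetic energy of a minimiser**: `T ≤ periodicEnergy = E₀^per ≤ C(N,2) L⁻³ ‖ṽ‖₁`
(`N = n + 1`; for `N = 1` both sides vanish). -/
theorem lintegral_kineticDensity_le_of_isMinimiser (hL : 0 < L) {v : ℝ → ℝ≥0∞} (hv : Measurable v)
    {n : ℕ} (Ψ : PeriodicTrialState (n + 1) L)
    (hmin : periodicEnergy v Ψ = periodicGroundStateEnergy v (n + 1) L) :
    ∫⁻ X in cellN (n + 1) L, kineticDensity Ψ.ψ X ≤
      (((n + 1).choose 2 : ℕ) : ℝ≥0∞) * ((ENNReal.ofReal L ^ 3)⁻¹ * ∫⁻ x : Space, v ‖x‖) := by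
  have hT : ∫⁻ X in cellN (n + 1) L, kineticDensity Ψ.ψ X ≤ periodicEnergy v Ψ :=
    lintegral_mono fun X => le_self_add
  refine hT.trans ?_
  rw [hmin]
  cases n with
  | zero => rw [periodicGroundStateEnergy_one hL]; exact bot_le
  | succ m => exact periodicGroundStateEnergy_le_pairs hL hv m

/-! ### The smooth class has integrable potentials -/

/-- **`‖ṽ‖₁ < ∞` for the smooth class**: a finite potential of finite range that is continuous as
`x ↦ v(|x|)` on `ℝ³` has `∫ v(|x|) dx < ∞`. -/
theorem lintegral_pot_lt_top {v : ℝ → ℝ≥0∞} (hfin : ∀ r, v r ≠ ⊤)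
    (hcont : Continuous fun x : Space => (v ‖x‖).toReal) {R₀ : ℝ} (hR : ∀ r, R₀ < r → v r = 0) :
    (∫⁻ x : Space, v ‖x‖) < ⊤ := by
  set R : ℝ := max R₀ 0 with hRdef
  obtain ⟨C, hC⟩ := (isCompact_closedBall (0 : Space) R).exists_bound_of_continuousOn hcont.continuousOn
  have hle : ∀ x : Space, v ‖x‖ ≤ (Metric.closedBall (0 : Space) R).indicator (fun _ => ENNReal.ofReal C) x := by
    intro x
    by_cases hx : x ∈ Metric.closedBall (0 : Space) R
    · rw [indicator_of_mem hx, ← ENNReal.ofReal_toReal (hfin _)]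
      exact ENNReal.ofReal_le_ofReal ((Real.le_norm_self _).trans (hC x hx))
    · rw [indicator_of_notMem hx]
      rw [Metric.mem_closedBall, dist_zero_right, not_le] at hx
      rw [hR _ (lt_of_le_of_lt (le_max_left _ _) hx)]
  calc (∫⁻ x : Space, v ‖x‖) ≤ ∫⁻ x, (Metric.closedBall (0 : Space) R).indicator (fun _ => ENNReal.ofReal C) x :=
        lintegral_mono hle
    _ = ENNReal.ofReal C * volume (Metric.closedBall (0 : Space) R) :=
        lintegral_indicator_const measurableSet_closedBall _
    _ < ⊤ := ENNReal.mul_lt_top ENNReal.ofReal_lt_top measure_closedBall_lt_top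

end Summit.AtomisticToContinuum.BoseEinsteinCondensation.Theorems.IMUChainGlue

end
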